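/-
Copyright: lit-balaban cell (HOME `run/shared/lean/pub/lit-balaban/`), Phase-2 proof seat p12 (gen 7).  The proofs reproduce the
printed arguments; nothing is claimed beyond what the kernel checks below.
-/
import Literature.MathematicalPhysics.QuantumFieldTheory.DybalskiStottmeisterTanimoto2024.DST24CriticalPointEquation

/-!
# `DybalskiStottmeisterTanimoto2024.DST24RstarBounds` — [DybalskiStottmeisterTanimoto2024] **§4.5, the `𝓛^∞` bounds on
# `R*_{A⃗}`** PROVED: (R-bound-one) `‖R*_{A⃗}‖_{∞,∞;Ω} ≤ 2`, (second-delta-estimate) `|A_{1,0} − A_{2,0}| ≤ 2ε|A⃗₁ − A⃗₂|`,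
# (R-bound-three) `‖R*_{A⃗₁} − R*_{A⃗₂}‖_{∞,∞;Ω} ≤ 2‖A⃗₁ − A⃗₂‖_{∞;Ω}`

statement-level skeleton of published theorems with citation tags; proofs where landed; nothing here is a claim about
the Yang–Mills mass gap

W. Dybalski, A. Stottmeister, Y. Tanimoto, *The Bałaban variational problem in the non-linear sigma model*, Rev. Math. Phys.
**36** (2024), arXiv:2403.09800; source held `paper:arxiv-2403.09800` (§4.5 = tex chunk p0016).  Unit `lit-balaban-p12` (gen 7);
`Rstar`, `A0` from `DST24TangentSpace`/`DST24Setting`, `RstarOp` from `DST24CriticalPointEquation`.  `R*_{A⃗}` acts sitewise, so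
its `‖·‖_{∞,∞;Ω}` operator norm is the supremum over sites of the operator norm on `ℝ³`; the bounds are stated pointwise (every site,
every vector), which is the content of the printed `sup`.

WHAT IS PRINTED (§4.5, Lemma with (R-bound-one), (R-bound-three)) AND PROVED HERE.  «For `A⃗, A⃗₁, A⃗₂ ∈ Conf⃗^ε(Ω)`,
`δ = δ₁ = δ₂ = 1`, `0 < ε ≤ 1/2`, there hold the bounds `‖R*_{A⃗}‖_{∞,∞;Ω} ≤ 2`, `‖R*_{A⃗₁} − R*_{A⃗₂}‖_{∞,∞;Ω} ≤ 2‖A⃗₁ − A⃗₂‖_{∞;Ω}`.»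
* (R-bound-one) «`|A₀(x)v⃗(x) − A⃗(x) × v⃗(x)| ≤ 2` … we used the fact that `|A⃗(x)| ≤ 1`» — `norm_Rstar_le`, `norm_RstarOp_le`.
* (second-delta-estimate) «`|A_{1,0} − A_{2,0}| = ||A⃗₂|² − |A⃗₁|²| / (√(1−|A⃗₁|²) + √(1−|A⃗₂|²)) ≤ 2ε|A⃗₁ − A⃗₂|`» — `abs_A0_sub_A0_le`.
* (R-bound-three) «`|(R_{A⃗₁}(x) − R_{A⃗₂}(x))v⃗(x)| ≤ (2ε + 1)|v⃗(x)||A⃗₁(x) − A⃗₂(x)|`», hence `≤ 2‖v‖‖A⃗₁ − A⃗₂‖` for `ε ≤ 1/2` —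
  `norm_Rstar_sub_Rstar_le`, `norm_RstarOp_sub_le`.
-/

namespace Literature.MathematicalPhysics.QuantumFieldTheory.DybalskiStottmeisterTanimoto2024.DST24RstarBounds

open scoped Quaternion RealInnerProductSpace BigOperators
open Literature.MathematicalPhysics.QuantumFieldTheory.Federbush1986
open Literature.MathematicalPhysics.QuantumFieldTheory.DybalskiStottmeisterTanimoto2024.DST24Setting
open Literature.MathematicalPhysics.QuantumFieldTheory.DybalskiStottmeisterTanimoto2024.DST24TangentSpace
open Literature.MathematicalPhysics.QuantumFieldTheory.DybalskiStottmeisterTanimoto2024.DST24CriticalPointEquation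

noncomputable section

variable {L n₁ : ℕ}

/-- `|A⃗ × v⃗| ≤ |A⃗||v⃗|`. [cite: DybalskiStottmeisterTanimoto2024, §4.5 proof of (R-bound-one)] -/
theorem norm_crossLin_le (A v : su2) : ‖crossLin A v‖ ≤ ‖A‖ * ‖v‖ := by
  rw [← su2.norm_coe, crossLin_coe, ← su2.norm_coe, ← su2.norm_coe]
  exact (SU2.norm_im_le _).trans (norm_mul_le _ _)

/-- `0 ≤ A₀ ≤ 1`. [cite: DybalskiStottmeisterTanimoto2024, §1.1 («`A₀(x) := √(1 − |A⃗(x)|²)`»)] -/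
theorem A0_le_one (A : su2) : A0 A ≤ 1 := by
  unfold A0
  calc Real.sqrt (1 - ‖A‖ ^ 2) ≤ Real.sqrt 1 := Real.sqrt_le_sqrt (by nlinarith [norm_nonneg A])
    _ = 1 := Real.sqrt_one

/-- `0 ≤ A₀`. [cite: DybalskiStottmeisterTanimoto2024, §1.1 («`A₀(x) := √(1 − |A⃗(x)|²)`»)] -/
theorem A0_nonneg (A : su2) : 0 ≤ A0 A := Real.sqrt_nonneg _

/-- **(R-bound-one)**, pointwise: `|R*_{A⃗}v⃗| = |A₀v⃗ − A⃗ × v⃗| ≤ 2|v⃗|` when `|A⃗| ≤ 1`.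
[cite: DybalskiStottmeisterTanimoto2024, §4.5 (R-bound-one)] -/
theorem norm_Rstar_le (A : su2) (hA : ‖A‖ ≤ 1) (v : su2) : ‖Rstar A v‖ ≤ 2 * ‖v‖ := by
  rw [Rstar_apply]
  calc ‖A0 A • v - crossLin A v‖ ≤ ‖A0 A • v‖ + ‖crossLin A v‖ := norm_sub_le _ _
    _ ≤ 1 * ‖v‖ + 1 * ‖v‖ := by
        refine add_le_add ?_ ((norm_crossLin_le A v).trans (mul_le_mul_of_nonneg_right hA (norm_nonneg _)))
        rw [norm_smul, Real.norm_of_nonneg (A0_nonneg A)]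
        exact mul_le_mul_of_nonneg_right (A0_le_one A) (norm_nonneg _)
    _ = 2 * ‖v‖ := by ring

/-- **(R-bound-one)** «`‖R*_{A⃗}‖_{∞,∞;Ω} ≤ 2`»: for `|A⃗(x)| ≤ 1` and `‖v⃗‖_{∞;Ω} ≤ 1`, `|(R*_{A⃗}v⃗)(x)| ≤ 2` at every site.
[cite: DybalskiStottmeisterTanimoto2024, §4.5 (R-bound-one)] -/
theorem norm_RstarOp_le (A : Site L n₁ → su2) (hA : ∀ x, ‖A x‖ ≤ 1) (v : Site L n₁ → su2) (hv : ∀ x, ‖v x‖ ≤ 1)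
    (x : Site L n₁) : ‖RstarOp A v x‖ ≤ 2 := by
  rw [RstarOp_apply]
  exact (norm_Rstar_le (A x) (hA x) (v x)).trans (by linarith [hv x])

/-- **(second-delta-estimate)** «`|A_{1,0} − A_{2,0}| = ||A⃗₂|² − |A⃗₁|²| / (√(1−|A⃗₁|²) + √(1−|A⃗₂|²)) ≤ 2ε|A⃗₁ − A⃗₂|`» for
`|A⃗₁|, |A⃗₂| ≤ ε ≤ 1/2`. [cite: DybalskiStottmeisterTanimoto2024, §4.5 (second-delta-estimate)] -/
theorem abs_A0_sub_A0_le {ε : ℝ} (hε' : ε ≤ 1 / 2) (A₁ A₂ : su2) (h₁ : ‖A₁‖ ≤ ε) (h₂ : ‖A₂‖ ≤ ε) :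
    |A0 A₁ - A0 A₂| ≤ 2 * ε * ‖A₁ - A₂‖ := by
  have hε : 0 ≤ ε := (norm_nonneg _).trans h₁
  have n₁0 := norm_nonneg A₁
  have n₂0 := norm_nonneg A₂
  set a := 1 - ‖A₁‖ ^ 2
  set b := 1 - ‖A₂‖ ^ 2
  have ha : 3 / 4 ≤ a := by nlinarith
  have hb : 3 / 4 ≤ b := by nlinarith
  have hsa : 1 / 2 ≤ Real.sqrt a := by
    rw [show (1 / 2 : ℝ) = Real.sqrt (1 / 4) by
      rw [show (1 / 4 : ℝ) = (1 / 2) ^ 2 by norm_num, Real.sqrt_sq (by norm_num)]]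
    exact Real.sqrt_le_sqrt (by linarith)
  have hsb : 1 / 2 ≤ Real.sqrt b := by
    rw [show (1 / 2 : ℝ) = Real.sqrt (1 / 4) by
      rw [show (1 / 4 : ℝ) = (1 / 2) ^ 2 by norm_num, Real.sqrt_sq (by norm_num)]]
    exact Real.sqrt_le_sqrt (by linarith)
  have hprod : (Real.sqrt a - Real.sqrt b) * (Real.sqrt a + Real.sqrt b) = a - b := by
    have e1 : Real.sqrt a ^ 2 = a := Real.sq_sqrt (by linarith)
    have e2 : Real.sqrt b ^ 2 = b := Real.sq_sqrt (by linarith)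
    nlinarith
  -- `|√a − √b| ≤ |√a − √b|(√a + √b) = |a − b|`
  have key : |Real.sqrt a - Real.sqrt b| ≤ |a - b| := by
    have hs1 : 1 ≤ Real.sqrt a + Real.sqrt b := by linarith
    calc |Real.sqrt a - Real.sqrt b| = |Real.sqrt a - Real.sqrt b| * 1 := (mul_one _).symm
      _ ≤ |Real.sqrt a - Real.sqrt b| * (Real.sqrt a + Real.sqrt b) := mul_le_mul_of_nonneg_left hs1 (abs_nonneg _)
      _ = |(Real.sqrt a - Real.sqrt b) * (Real.sqrt a + Real.sqrt b)| := by
          rw [abs_mul, abs_of_pos (by linarith : 0 < Real.sqrt a + Real.sqrt b)]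
      _ = |a - b| := by rw [hprod]
  -- `|a − b| = ||A₂|² − |A₁|²| = (|A₁| + |A₂|)·||A₁| − |A₂|| ≤ 2ε|A⃗₁ − A⃗₂|`
  have hab : |a - b| ≤ 2 * ε * ‖A₁ - A₂‖ := by
    have e : a - b = (‖A₂‖ + ‖A₁‖) * (‖A₂‖ - ‖A₁‖) := by ring
    rw [e, abs_mul, abs_of_nonneg (by positivity)]
    have h3 : |‖A₂‖ - ‖A₁‖| ≤ ‖A₁ - A₂‖ := by
      rw [abs_sub_comm]; exact abs_norm_sub_norm_le A₁ A₂
    calc (‖A₂‖ + ‖A₁‖) * |‖A₂‖ - ‖A₁‖| ≤ (ε + ε) * ‖A₁ - A₂‖ :=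
          mul_le_mul (add_le_add h₂ h₁) h3 (abs_nonneg _) (by linarith)
      _ = 2 * ε * ‖A₁ - A₂‖ := by ring
  unfold A0
  exact key.trans hab

/-- **(R-bound-three)**, pointwise: «`|(R*_{A⃗₁}(x) − R*_{A⃗₂}(x))v⃗| ≤ (2ε + 1)|v⃗||A⃗₁ − A⃗₂|`» (`|A⃗ᵢ| ≤ ε ≤ 1/2`).
[cite: DybalskiStottmeisterTanimoto2024, §4.5 (R-bound-three), proof] -/
theorem norm_Rstar_sub_Rstar_le {ε : ℝ} (hε' : ε ≤ 1 / 2) (A₁ A₂ : su2) (h₁ : ‖A₁‖ ≤ ε) (h₂ : ‖A₂‖ ≤ ε) (v : su2) :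
    ‖Rstar A₁ v - Rstar A₂ v‖ ≤ (2 * ε + 1) * ‖v‖ * ‖A₁ - A₂‖ := by
  have hd := abs_A0_sub_A0_le hε' A₁ A₂ h₁ h₂
  have e : Rstar A₁ v - Rstar A₂ v = (A0 A₁ - A0 A₂) • v - crossLin (A₁ - A₂) v := by
    apply Subtype.ext
    simp only [Rstar_coe, Submodule.coe_sub, Submodule.coe_smul, crossLin_coe, sub_mul, Quaternion.im_sub, sub_smul]
    abel
  rw [e]
  calc ‖(A0 A₁ - A0 A₂) • v - crossLin (A₁ - A₂) v‖ ≤ ‖(A0 A₁ - A0 A₂) • v‖ + ‖crossLin (A₁ - A₂) v‖ := norm_sub_le _ _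
    _ ≤ 2 * ε * ‖A₁ - A₂‖ * ‖v‖ + ‖A₁ - A₂‖ * ‖v‖ := by
        rw [norm_smul, Real.norm_eq_abs]
        exact add_le_add (mul_le_mul_of_nonneg_right hd (norm_nonneg _)) (norm_crossLin_le _ _)
    _ = (2 * ε + 1) * ‖v‖ * ‖A₁ - A₂‖ := by ring

/-- **(R-bound-three)** «`‖R*_{A⃗₁} − R*_{A⃗₂}‖_{∞,∞;Ω} ≤ 2‖A⃗₁ − A⃗₂‖_{∞;Ω}`» (`ε ≤ 1/2`): at every site,
`|((R*_{A⃗₁} − R*_{A⃗₂})v⃗)(x)| ≤ 2 · sup_x|A⃗₁ − A⃗₂|` for `‖v⃗‖_{∞;Ω} ≤ 1`. [cite: DybalskiStottmeisterTanimoto2024, §4.5 (R-bound-three)] -/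
theorem norm_RstarOp_sub_le {ε : ℝ} (hε' : ε ≤ 1 / 2) (A₁ A₂ : Site L n₁ → su2) (h₁ : ∀ x, ‖A₁ x‖ ≤ ε) (h₂ : ∀ x, ‖A₂ x‖ ≤ ε)
    {δ : ℝ} (hδ : ∀ x, ‖A₁ x - A₂ x‖ ≤ δ) (v : Site L n₁ → su2) (hv : ∀ x, ‖v x‖ ≤ 1) (x : Site L n₁) :
    ‖RstarOp A₁ v x - RstarOp A₂ v x‖ ≤ 2 * δ := by
  have hε : 0 ≤ ε := (norm_nonneg _).trans (h₁ x)
  have hδ0 : 0 ≤ δ := (norm_nonneg _).trans (hδ x)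
  rw [RstarOp_apply, RstarOp_apply]
  have h := norm_Rstar_sub_Rstar_le hε' (A₁ x) (A₂ x) (h₁ x) (h₂ x) (v x)
  calc ‖Rstar (A₁ x) (v x) - Rstar (A₂ x) (v x)‖ ≤ (2 * ε + 1) * ‖v x‖ * ‖A₁ x - A₂ x‖ := h
    _ ≤ 2 * 1 * δ := by
        have h3 : (2 * ε + 1) ≤ 2 := by linarith
        have := mul_le_mul (mul_le_mul h3 (hv x) (norm_nonneg _) (by norm_num)) (hδ x) (norm_nonneg _) (by norm_num)
        exact this
    _ = 2 * δ := by ring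

end

end Literature.MathematicalPhysics.QuantumFieldTheory.DybalskiStottmeisterTanimoto2024.DST24RstarBounds
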